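import Summits.HodgeConjecture.HodgeConjecture.Theses.BoundaryReadout
import Literature.AlgebraicGeometry.HodgeTheory.ComplexConjugationHolds
import Literature.AlgebraicGeometry.HodgeTheory.AlgebraicClassesPullback
import Literature.AlgebraicGeometry.HodgeTheory.HodgeConjectureQbarVoisin

/-!
# Birth skeleton (BC3) of the crux `AbsoluteReduction` — Voisin's funnel cut along its own proof

Crux `stmt-HodgeConjecture-15945` of route `BoundaryReadout` (rank 9, `support→crux`: it is a hypothesis
of the crux-only deciding theorem `closes` and not yet a proved lemma of the tree):

  `AbsoluteReduction := HCOverNumberFields → ∀ ⦃n X⦄, IsSmoothProjective n X →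
     Nonempty (HodgeModel n X) ∧ ∀ p (c : H²ᵖ(X(ℂ); ℂ)), IsAbsoluteHodgeClass n X p c → c ∈ algebraicClasses X p`

— Voisin 2007, Prop. 1.2 (arXiv:math/0605766 p. 2; proof §3, p. 6, READ) = Charles–Schnell 2014,
Thm. 11.3.17 + Thm. 11.3.19 (held book cattani2014 pp. 488–490, READ): *the Hodge conjecture for
varieties over number fields implies it for (de Rham) absolute Hodge classes on every smooth projective
complex variety*, bundled with the PROVED anti-vacuity conjunct (tree theorem
`HodgeTheory.nonempty_hodgeModel_holds`, Serre GAGA + de Rham + Hodge decomposition).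

Registrar skeleton (`skeleton-register`, planner one-shot). The named Literature fact
`voisin2007_hodgeConjecture_absolute_of_qbar` (file `HodgeConjectureQbarVoisin`, UNPROVED) is Prop. 1.2
itself with `ℚ̄` for "number field" and is deliberately NOT a stub (it would be the crux in costume);
instead the skeleton cuts Voisin's one-page proof (p. 6) at its two seams:

* `stub_absoluteSpread` — THE ARITHMETIC HALF (spreading out +
  fields of definition + global invariant cycles): an absolute Hodge class `c` on `X` lies in the image of `h^* : H²ᵖ(W(ℂ); ℂ) → H²ᵖ(X(ℂ); ℂ)`
  for some `ℂ`-morphism `h : X ⟶ W` into a smooth projective `W` DEFINABLE OVER A NUMBER FIELD.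
  Intended witness (Voisin p. 6, lines 5–27; C–S Thm. 11.3.17, 11.3.19, 11.3.4): spread `(X, c)` to a
  smooth projective family `π : 𝒳 → T` over `ℚ̄` with `X ≅ 𝒳_t`; `c` absolute ⇒ the component of the
  locus of Hodge classes through `c` is defined over `ℚ̄` (Cattani–Deligne–Kaplan algebraicity +
  countably many Galois translates, Voisin Lemma 2.4 / C–S Thm. 11.3.17), so after base change to (a
  desingularised) it `c` extends to a flat global section `α̃ ∈ H⁰(T, R²ᵖπ_*ℚ)`; Deligne's global
  invariant cycle theorem (Hodge II, 4.1.1 = C–S Thm. 11.3.4) on a smooth projective completion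
  `W = 𝒳̄` chosen over `ℚ̄` gives `b ∈ H²ᵖ(W)` with `b|_X = c`; `h = (X ≅ 𝒳_t ↪ 𝒳 ↪ W)`; a `ℚ̄`-variety
  of finite type descends to a number field (EGA IV 8.8.2). OPEN on the tree (L-sized; hardest stub).
* `stub_hodgeLift` — THE HODGE-THEORETIC HALF (polarisation /
  semisimplicity): if `h : Y ⟶ W` is a `ℂ`-morphism of smooth projective varieties and `h^* b` is a rational `(p,p)` class for some complex
  class `b` on `W`, then `h^* b = h^* c'` for a rational `(p,p)` class `c'` ON `W` (rational descent of
  the image, then `H²ᵖ(W, ℚ) = Ker h^* ⊕ (Ker h^*)^⊥` for a polarisation and `(Ker h^*)^⊥ ≅ Im h^*` as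
  Hodge structures: C–S proof of Prop. 11.3.5, p. 480, "hence a Hodge class `a ∈ (Ker i₀^*)^⊥` mapping
  to `α`"; Voisin p. 6 "`H²ᵏ(𝒳̄, ℚ) = A ⊕ B`"; Deligne Hodge II 4.1.1–4.1.2; Peters–Steenbrink Cor. 2.12).
  OPEN on the tree (M-sized: needs the polarised Hodge structure on `H²ᵖ(W(ℂ); ℚ)` through Hodge
  models and that `h^*` is a morphism of Hodge structures).
* `stub_pullbackAlgebraic` — pull-back preserves algebraic classes: VERBATIM the route's open support
  item `PullbackAlgebraic` (stmt-HodgeConjecture-1071, shared with `QbarEnvelope`), used BY NAME; it is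
  the binder-reordering `fulton1998_map_mem_algebraicClasses.pullbackAlgebraic` of the Literature named
  fact (Fulton 1998 Cor. 19.2 (b); Voisin II Prop. 9.21 (i)). M-sized (cycle class with supports on
  the carrier `algebraicClasses = Nᵖ H²ᵖ`). Closes by `PullbackAlgebraic_holds` when that item lands.
* `AbsoluteReduction_of (hS : Sig.stub_absoluteSpread) (hL : Sig.stub_hodgeLift) (hP : PullbackAlgebraic) :
  AbsoluteReduction` (no `sorry`; the sorries live only in the `stub_*` theorems of §1, whose statements are named BY NAME as
  the Props `Sig.stub_*` of §2, and `AbsoluteReduction_of_stubs` feeds them in): models conjunct by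
  `nonempty_hodgeModel_holds`; for an absolute `c`: spread `c = h^* b` (stub 1), lift `h^* b = h^* c'` with `c'` Hodge on `W` (stub 2; `h^* b = c` is
  rational `(p,p)` because absolute Hodge classes are), `c'` algebraic by `HCOverNumberFields` on `W`,
  `c = h^* c'` algebraic by stub 3. Concludes the crux BY NAME.

Disproof used: none (no `Disproof.lean` / Negative lemmas exist for this crux; `ledger crux ls` empty).
Negatives index (HodgeConjecture): the refuted Fermat / K3-lattice statements are not instances of any stub.
No stub is cheaply the crux or the summit (BC3 probes: registrar folder `bc/`, table in
`Cruxes/AbsoluteReduction/BC3-PROBES.md`). `sorry` occurs only inside the three `stub_*` theorems.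
-/

set_option linter.dupNamespace false

namespace Summit.HodgeConjecture.HodgeConjecture.Cruxes.AbsoluteReduction.Birth

open CategoryTheory
open Literature.AlgebraicGeometry.Motives Literature.AlgebraicGeometry.HodgeTheory
open Summit.HodgeConjecture.HodgeConjecture.Theses.BoundaryReadout

/-! ## §1 Registered stubs (`theorem stub_<name> : <signature> := by sorry` — the ONLY sorries of the file) -/

/-- **Stub 1 (L, hardest) — absolute Hodge classes are spread from varieties over number fields** (the
arithmetic half of Voisin's Prop. 1.2): for `X` smooth projective over `ℂ` and `c ∈ H²ᵖ(X(ℂ); ℂ)` an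
absolute Hodge class, there are a smooth projective `W` over `ℂ` admitting a model over a number field
(`W ≅ W₀ ×_{K,σ} ℂ`), a `ℂ`-morphism `h : X ⟶ W` and a class `b ∈ H²ᵖ(W(ℂ); ℂ)` with `h^* b = c`
(witness: `W` = smooth projective completion over `ℚ̄` of the spread family over the `ℚ̄`-defined Hodge
locus of `c`, `b` = Deligne's invariant-cycle lift of the flat section through `c`, `h` = fibre
inclusion). [Voisin2007HodgeLoci §3 proof of Prop. 1.2 (arXiv p. 6), Lemma 2.4, Thm. 2.3 (= CDK);
CharlesSchnell2014Notes Thm. 11.3.17 (p. 488), Thm. 11.3.19 (pp. 489–490), Thm. 11.3.4 (p. 478);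
DeligneHodgeII1971 Thm. 4.1.1; CattaniDeligneKaplan1995JAMS Thm. 1.1; EGA IV 8.8.2] -/
theorem stub_absoluteSpread :
    ∀ ⦃n : ℕ⦄ ⦃X : SchemeOver ℂ⦄, IsSmoothProjective n X →
      ∀ (p : ℕ) (c : complexBetti X (2 * p)), IsAbsoluteHodgeClass n X p c →
        ∃ (m : ℕ) (W : SchemeOver ℂ) (h : X ⟶ W) (b : complexBetti W (2 * p)),
          IsSmoothProjective m W ∧
            (∃ (K : Type) (_ : Field K) (_ : NumberField K) (σ : K →+* ℂ) (W₀ : SchemeOver K),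
              Nonempty (W ≅ (baseChangeHom σ).obj W₀)) ∧
            complexBetti.map h (2 * p) b = c := by
  sorry

/-- **Stub 2 (M) — Hodge classes in the image of a pull-back lift to Hodge classes** (the
Hodge-theoretic half: rational descent of the image plus semisimplicity of polarisable Hodge structures):
for a `ℂ`-morphism `h : Y ⟶ W` of smooth projective varieties and a complex class `b ∈ H²ᵖ(W(ℂ); ℂ)`
whose pull-back `h^* b` is a rational class of Hodge type `(p,p)` on `Y`, there is a rational class `c'`
of Hodge type `(p,p)` on `W` with `h^* c' = h^* b` (`Im h^*_ℂ ∩ H²ᵖ(Y, ℚ) = Im h^*_ℚ`; then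
`H²ᵖ(W, ℚ) = Ker h^* ⊕ (Ker h^*)^⊥` for a polarisation, `(Ker h^*)^⊥ ⥲ Im h^*` an isomorphism of Hodge
structures, so the Hodge class `h^* b` of the sub-Hodge structure `Im h^*` has a Hodge preimage).
[CharlesSchnell2014Notes proof of Prop. 11.3.5 (p. 480); Voisin2007HodgeLoci §3 (arXiv p. 6,
`H²ᵏ(𝒳̄, ℚ) = A ⊕ B`); DeligneHodgeII1971 4.1.1–4.1.2; PetersSteenbrink2008 Cor. 2.12] -/
theorem stub_hodgeLift :
    ∀ ⦃m : ℕ⦄ ⦃W : SchemeOver ℂ⦄, IsSmoothProjective m W →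
      ∀ ⦃n : ℕ⦄ ⦃Y : SchemeOver ℂ⦄, IsSmoothProjective n Y →
        ∀ (h : Y ⟶ W) (p : ℕ) (b : complexBetti W (2 * p)),
          IsRationalClass (complexBetti.map h (2 * p) b) →
            IsOfHodgeType n Y (2 * p) p p (complexBetti.map h (2 * p) b) →
              ∃ c' : complexBetti W (2 * p), IsRationalClass c' ∧ IsOfHodgeType m W (2 * p) p p c' ∧
                complexBetti.map h (2 * p) c' = complexBetti.map h (2 * p) b := by
  sorry

/-- **Stub 3 (M) — pull-back preserves algebraic classes**: VERBATIM the route's open support item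
`BoundaryReadout.PullbackAlgebraic` (stmt-HodgeConjecture-1071; `@[route_item]`, shared with `QbarEnvelope`),
by name — for `ι : X ⟶ W` a `ℂ`-morphism of smooth projective varieties,
`ι^*(Nᵖ H²ᵖ(W(ℂ); ℂ)) ⊆ Nᵖ H²ᵖ(X(ℂ); ℂ)`. It is exactly the route-shaped corollary
`fulton1998_map_mem_algebraicClasses.pullbackAlgebraic` of the Literature named fact (a binder reordering,
proved in `AlgebraicClassesPullback`; see the `example` below) and closes by `PullbackAlgebraic_holds` once
item 1071 is proved. [Fulton1998 §19.2 Cor. 19.2 (b), Prop. 19.2, §19.1 Lemma 19.1.1; VoisinHodgeII2003 Prop. 9.21 (i)] -/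
theorem stub_pullbackAlgebraic : PullbackAlgebraic := by
  sorry

/-- Stub 3 from the Literature named fact `fulton1998_map_mem_algebraicClasses` (binder reordering). -/
example (h : fulton1998_map_mem_algebraicClasses) : PullbackAlgebraic :=
  h.pullbackAlgebraic

/-! ## §2 Stub statements by name: `Sig.stub_<name> : Prop` (the admissible hypotheses of `AbsoluteReduction_of`)

The statement of each registered stub, restated as a named `Prop` whose LAST name component is the stub's own
name — this is how `#h21_check_skeleton` admits it as a hypothesis of the assembly ("declared stubs, by
name") without any gate-reserved attribute, so this tree copy and the registrar's work copy are
byte-identical and `ledger skeleton check` passes on the TREE path whichever concluding theorem it inspects.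
The `example`s pin each restatement to its stub definitionally (they are the stub's type, verbatim). -/

/-- The statement of `stub_absoluteSpread` (absolute Hodge classes are spread from varieties over number
fields), verbatim, as a named `Prop`. [Voisin2007HodgeLoci Prop. 1.2] -/
def Sig.stub_absoluteSpread : Prop :=
  ∀ ⦃n : ℕ⦄ ⦃X : SchemeOver ℂ⦄, IsSmoothProjective n X →
    ∀ (p : ℕ) (c : complexBetti X (2 * p)), IsAbsoluteHodgeClass n X p c →
      ∃ (m : ℕ) (W : SchemeOver ℂ) (h : X ⟶ W) (b : complexBetti W (2 * p)),
        IsSmoothProjective m W ∧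
          (∃ (K : Type) (_ : Field K) (_ : NumberField K) (σ : K →+* ℂ) (W₀ : SchemeOver K),
            Nonempty (W ≅ (baseChangeHom σ).obj W₀)) ∧
          complexBetti.map h (2 * p) b = c

/-- The statement of `stub_hodgeLift` (Hodge classes in the image of a pull-back lift to Hodge classes),
verbatim, as a named `Prop`. [CharlesSchnell2014Notes Prop. 11.3.5 proof] -/
def Sig.stub_hodgeLift : Prop :=
  ∀ ⦃m : ℕ⦄ ⦃W : SchemeOver ℂ⦄, IsSmoothProjective m W →
    ∀ ⦃n : ℕ⦄ ⦃Y : SchemeOver ℂ⦄, IsSmoothProjective n Y →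
      ∀ (h : Y ⟶ W) (p : ℕ) (b : complexBetti W (2 * p)),
        IsRationalClass (complexBetti.map h (2 * p) b) →
          IsOfHodgeType n Y (2 * p) p p (complexBetti.map h (2 * p) b) →
            ∃ c' : complexBetti W (2 * p), IsRationalClass c' ∧ IsOfHodgeType m W (2 * p) p p c' ∧
              complexBetti.map h (2 * p) c' = complexBetti.map h (2 * p) b

/-- `Sig.stub_absoluteSpread` IS the type of `stub_absoluteSpread` (definitional; no `sorry` of its own). -/
example : Sig.stub_absoluteSpread := stub_absoluteSpread

/-- `Sig.stub_hodgeLift` IS the type of `stub_hodgeLift` (definitional; no `sorry` of its own). -/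
example : Sig.stub_hodgeLift := stub_hodgeLift

/-! ## §3 Assembly -/

/-- **Assembly, implication form** (kernel-checked, no `sorry`): the three stub statements imply the
crux `BoundaryReadout.AbsoluteReduction`, concluded BY NAME. Given `HCOverNumberFields` and `X` smooth
projective: the Hodge-model conjunct is the tree theorem `nonempty_hodgeModel_holds`; an absolute Hodge
class `c` is `h^* b` with `W` over a number field (`Sig.stub_absoluteSpread`); since `c` is rational of
type `(p,p)` (`IsAbsoluteHodgeClass.1/.2.1`), `Sig.stub_hodgeLift` gives a rational `(p,p)` class `c'` on `W` with
`h^* c' = c`; `HCOverNumberFields` on `W` makes `c'` algebraic; `PullbackAlgebraic` pulls algebraicity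
back along `h`. [Voisin2007HodgeLoci Prop. 1.2; CharlesSchnell2014Notes Thm. 11.3.19] -/
theorem AbsoluteReduction_of (hS : Sig.stub_absoluteSpread) (hL : Sig.stub_hodgeLift)
    (hP : PullbackAlgebraic) :
    Summit.HodgeConjecture.HodgeConjecture.Theses.BoundaryReadout.AbsoluteReduction := by
  unfold Summit.HodgeConjecture.HodgeConjecture.Theses.BoundaryReadout.AbsoluteReduction
  intro hQ n X hX
  -- conjunct 1: a Hodge model exists (tree theorem); conjunct 2: absolute ⇒ algebraic via the funnel
  refine ⟨nonempty_hodgeModel_holds hX, fun p c hc ↦ ?_⟩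
  -- spread: `c = h^* b`, `W` smooth projective with a model over a number field
  obtain ⟨m, W, h, b, hW, hWK, hb⟩ := hS hX p c hc
  subst hb
  -- lift: `h^* b = h^* c'` with `c'` a rational `(p,p)` class on `W` (an absolute class is rational `(p,p)`)
  obtain ⟨c', hc'r, hc'h, hc'eq⟩ := hL hW hX h p b hc.1 hc.2.1
  rw [← hc'eq]
  -- HC over number fields on `W`, then pull back along `h`
  exact hP hX hW h p c' ((hQ hW hWK).2 p c' hc'r hc'h)

/-- **The crux from its registered stubs, by name** (no `sorry` of its own; its closure is
conditional on the three `stub_*` placeholders until they are proved). -/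
theorem AbsoluteReduction_of_stubs :
    Summit.HodgeConjecture.HodgeConjecture.Theses.BoundaryReadout.AbsoluteReduction :=
  AbsoluteReduction_of stub_absoluteSpread stub_hodgeLift stub_pullbackAlgebraic

end Summit.HodgeConjecture.HodgeConjecture.Cruxes.AbsoluteReduction.Birth
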